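import Literature.MathematicalPhysics.QuantumFieldTheory.Balaban1983to89.B9WalkLettersOpsFacts

/-!
# `Balaban1983to89.B9WalkLettersOpsLocality` — W-a FILE C-2 (part 3e, proofs): THE N06 CERTIFICATE'S rows-18 BINDER `hloc : LocalityDir (𝔬 x) (𝔡 x) (𝔩 x) (rd x)`
# DISCHARGED AT THE WALK LETTERS OF RECORD (`B9WalkLettersOps.opsWalkY`, reading `rdWalkY`) — print's «G′_□ depends on U restricted to Ω₀(□) ⊂ □̃⁵, and the
# operator K(h) is semi-local» (p. 410) for the genuine letters

statement-level skeleton of published theorems with citation tags; proofs where landed; nothing here is a claim about the Yang–Mills mass gap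

B9 = T. Bałaban, *Propagators for lattice gauge theories in a background field*, Commun. Math. Phys. **99** (1985) 389–434 [Balaban1985BackgroundPropagators];
[4] = T. Bałaban, *Propagators and renormalization transformations for lattice gauge theories. II*, Commun. Math. Phys. **96** (1984) 223–250 [Balaban1984PropagatorsII].
THE PRINT.  Cor. 3.8 p.410 L14–15: *"A propagator G′_□ depends on U restricted to Ω₀(□) ⊂ □̃⁵, and the operator K(h) is semi-local"* — the two locality
inputs of the random-walk expansion (3.90) p.409 (`G′₀ = Σ_□ h_□G′_□h_□` (3.87), `K(h_□) = Σ_μ P_□,μ∇_{U,μ} + C_□` (3.88)); (3.24) p.394 (`Δ′_a(U)` reads the bond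
variables `U_μ(z)`, `U_μ(z − e_μ)` and the averaging transporters of the block of `z`); [4] (2.37)–(2.39) p.229.
WHY THIS FILE (pub-ymgap, dag-n06-d W-a C-2 programme, HOME `W-a-C2-PLAN.md` §6, part 3e).  The N06 certificate (edition 46, `Summit…N06AtOpsYNuOfRecordV6EPairOA`)
DISPLAYS `hloc : ∀ x, LocalityDir (𝔬 x) (𝔡 x) (𝔩 x) (rd x)` (`B9Cor38WholeDir.LocalityDir`: clause `gsq` — `M_{h_□}G′_□(U)M_{h_□} = M_{h_□}G′_□(U′)M_{h_□}`, clause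
`kgh` — `K(h_□)(U)G′_□(U)M_{h_□} = K(h_□)(U′)G′_□(U′)M_{h_□}`, whenever `rd.Agree □ U U′`).  At the record `𝔬 := opsWalkY`, `𝔡 := dirOpsWalkY`, `𝔩 := dirLettersWalkY`,
`rd := rdWalkY` (`Agree := agreeWalkY`: the bond variables one lattice step around `□̃(c)` and the averaging transporters issuing from `□̃(c)` coincide) both
clauses are THEOREMS:
* §1 (def-Y ∕ M5.7 objects, any transporter letter `par`) `KhY_apply_congr_of_reads` — `(K(h)(U)Λ)(z)` reads `U` only at the bonds `U_μ(z)` with `h(z + e_μ) ≠ h(z)`,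
  `U_μ(z − e_μ)` with `h(z − e_μ) ≠ h(z)`, and at the averaging transporters `T(z,w)` with `avgCoeffY(z,w) ≠ 0`, `h(z) ≠ h(w)` (M5.7's stencil formula `KhY_apply`);
* §2 (the member's cube domains) `mem_nearDomY_iff`, `cubeDomY_subset_nearDomY`, `mem_nearDomY_of_fdiff ∕ _of_bdiff` (a non-zero difference of `h_□` across a bond puts
  its base point one step from `□̃`), `mem_cubeDomY_of_avg` (a non-zero difference of `h_□` across an averaging pair puts the pair in `□̃`: block-mates);
* §3 ★ `GsqY_congr_of_agreeWalkY` (def-Y's `GsqY_congr_of_agree` fed by `agreeWalkY`), `gsqcoS_congr_of_agreeWalkY`, ★★ `KhY_GsqY_cutMulY_congr_of_agreeWalkY` (the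
  𝔸-level `kgh`: `K(h_□)(U)G′_□(U)M_{h_□} = K(h_□)(U′)G′_□(U′)M_{h_□}` as OPERATORS), `kopDir_opsWalkY_eq` (the record's `KopDir` IS `(η²c_R)⁻¹•φ(K(h_□)(U))` for the
  coordinate algebra morphism `φ = coordAlgHom` of part 1, by def-Y's split `KhY_eq_grad_right`);
* §4 ★★★ `localityDir_opsWalkY : LocalityDir (opsWalkY …) (dirOpsWalkY …) (dirLettersWalkY …) (rdWalkY …)` — hypothesis-free.
With `B9WalkLettersOpsFacts` (`staticOK_opsWalkY`, `bounded_kappaWalkY`, `identities₂_opsWalkY`) this completes the record-side of the rows-18 static binders except the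
walk reading's `off` clause (`WalkReading.OKRel`, def-Y ruling on WORD-W1, l.42897: n06-c's structure + two Cor-3.8 lines; the record inhabits it by
`B9CoReadingCoordsS.off_bound_evSK`).
HONEST SCOPE.  Locality bookkeeping of def-Y's letters (`GsqY`, `deltaPrimeAY`, `KhY`) through the coordinate model; no estimate, no regime, no (3.42); nothing of [B9]'s
analysis asserted; count-neutral; N06 NOT discharged; nothing continuum ∕ OS ∕ mass gap ∕ Clay.  Cell `pub-ymgap` (D-0062), node N06 [B9], rows 18, seat
`pub-ymgap-dag-n06-d` (gen 15).  Net new unproved facts: 0.  NEW file.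
-/

noncomputable section

namespace Literature.MathematicalPhysics.QuantumFieldTheory.Balaban1983to89.B9WalkLettersOpsLocality

open Node00
open B6KLevelCensusIndexV1 (KIdx)
open B6Cover236MultiLevelBlocks (cubes)
open B6Geom246MultiLevelBox (blkOf)
open B4TorusKernel.MultiPeriod (torusSupNorm)
open B9Thm37Sum (mulOp)
open B9Thm37KLetterDir (KopDir)
open B9Cor38WholeDir (LocalityDir)
open B9Thm37CubeCoverCommutators (hTY cutMulY KhY KhY_apply)
open B9Thm37CommutatorBound389 (torusSupNorm_sub_shiftY_le_one)
open B9Thm39ReadingCoords (cR39)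
open B9Ineq349SiteComposite (cdSL)
open B9PinMembersKLevelV1 (MemberY geo9Y)
open B9CoReadingCoordsS (XSK GcoS)
open Node00.OpsYLocalInverse (GsqY GsqY_congr_of_agree)
open Node00.OpsYLeibnizLetters (pKY cKY KhY_eq_grad_right)
open B9WalkLettersCoordsS (cubeBlksY cubeDomY hWalkY gsqcoS mem_cubeDomY_of_hTY_ne_zero)
open B9WalkLettersCoordsLeib (mulcoS pcoS ccoS dirDcoS coordAlgHom)
open B9WalkLettersKernelsStatic (touch_self blkOf_eq_of_avgCoeffY_ne_zero)
open B9WalkLettersOps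
open B9WalkLettersOpsFacts (mulOp_hWalkY_eq_mulcoS)

/-! ## §1 `K(h)(U)` reads `U` only where `h` varies -/

section Reads

variable {𝔸 : Type} [NormedRing 𝔸] [NormedAlgebra ℂ 𝔸] [CompleteSpace 𝔸]
variable {d ℓ : ℕ} {hd : 1 ≤ d + 1} {hL : Odd (ℓ + 1) ∧ 1 < ℓ + 1} {b₀ b₁ : ℝ} (i : KIdx d ℓ hd hL b₀ b₁)

/-- ★ **`(K(h)(U)Λ)(z)` READS THE CONFIGURATION ONLY WHERE `h` VARIES**: two configurations with the same bond variable `U_μ(z)` whenever `h(z + e_μ) ≠ h(z)`, the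
same `U_μ(z − e_μ)` whenever `h(z − e_μ) ≠ h(z)`, and the same averaging transporter `T(z,w)` whenever `avgCoeffY(z,w) ≠ 0` and `h(z) ≠ h(w)`, give the same
`(K(h)Λ)(z)` — every coefficient of M5.7's stencil formula (`KhY_apply`) is such a difference. [cite: Balaban1985BackgroundPropagators, (3.88) p.409, p.410 L15 («K(h) is semi-local»), (3.24) p.394] -/
theorem KhY_apply_congr_of_reads (par : SiteParY 𝔸 i) (h : SiteY i → ℝ) {U U' : CfgY 𝔸 i} (Λ : SiteY i → 𝔸) (z : SiteY i)
    (hf : ∀ μ, h (shiftY i μ z) ≠ h z → UboxY i U μ z = UboxY i U' μ z)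
    (hb : ∀ μ, h ((shiftY i μ).symm z) ≠ h z → UboxY i U μ ((shiftY i μ).symm z) = UboxY i U' μ ((shiftY i μ).symm z))
    (hpar : ∀ w, avgCoeffY i z w ≠ 0 → h z ≠ h w → avgTrY i par U z w = avgTrY i par U' z w) :
    KhY i par h U Λ z = KhY i par h U' Λ z := by
  rw [KhY_apply, KhY_apply]
  congr 1
  · refine Finset.sum_congr rfl fun μ _ => ?_
    congr 1
    · by_cases h1 : h (shiftY i μ z) = h z
      · rw [h1, sub_self, Complex.ofReal_zero, zero_smul, zero_smul]
      · rw [hf μ h1]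
    · by_cases h2 : h ((shiftY i μ).symm z) = h z
      · rw [h2, sub_self, Complex.ofReal_zero, zero_smul, zero_smul]
      · rw [hb μ h2]
  · refine Finset.sum_congr rfl fun w _ => ?_
    by_cases hw : avgCoeffY i z w = 0
    · rw [hw, zero_mul, Complex.ofReal_zero, zero_smul, zero_smul]
    · by_cases h3 : h z = h w
      · rw [h3, sub_self, mul_zero, Complex.ofReal_zero, zero_smul, zero_smul]
      · rw [hpar w hw h3]

end Reads

/-! ## §2 The one-step neighbourhood `nearDomY` of `□̃(c)` -/

section Near

variable {d ℓ : ℕ} {hd : 1 ≤ d + 1} {hL : Odd (ℓ + 1) ∧ 1 < ℓ + 1} {b₀ b₁ : ℝ} {Mstar : ℕ}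
variable (x : MemberY d ℓ hd hL b₀ b₁ Mstar)

/-- `nearDomY`, unfolded: the sites within torus distance `1` of `□̃(c)`. [cite: Balaban1985BackgroundPropagators, p.410 L14–15 («Ω₀(□) ⊂ □̃⁵»), bookkeeping] -/
theorem mem_nearDomY_iff (c : ↥(cubes x.toKIdx.D.toDomains)) (z : SiteY x.toKIdx) :
    z ∈ nearDomY x c ↔ ∃ w ∈ cubeDomY x c, torusSupNorm (toKT x.toKIdx).NB (z.1 - w.1) ≤ 1 := by
  unfold nearDomY
  simp only [Finset.mem_filter, Finset.mem_univ, true_and]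

/-- `□̃(c) ⊂ nearDomY(c)`. [cite: Balaban1985BackgroundPropagators, p.410 L14–15, bookkeeping] -/
theorem cubeDomY_subset_nearDomY (c : ↥(cubes x.toKIdx.D.toDomains)) : cubeDomY x c ⊆ nearDomY x c :=
  fun z hz => (mem_nearDomY_iff x c z).2 ⟨z, hz, touch_self x z⟩

/-- a bond `⟨z, z + e_μ⟩` across which `h_□` varies has its base point one step from `□̃(c)` (`supp h_□ ⊂ □̃(c)`).
[cite: Balaban1985BackgroundPropagators, (3.88)–(3.89) p.409, p.410 L14–15; Balaban1984PropagatorsII, p.235] -/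
theorem mem_nearDomY_of_fdiff (c : ↥(cubes x.toKIdx.D.toDomains)) (μ : Fin (d + 1)) {z : SiteY x.toKIdx}
    (h : hTY x.toKIdx c (shiftY x.toKIdx μ z) ≠ hTY x.toKIdx c z) : z ∈ nearDomY x c := by
  by_cases hz : hTY x.toKIdx c z ≠ 0
  · exact cubeDomY_subset_nearDomY x c (mem_cubeDomY_of_hTY_ne_zero x c hz)
  · push Not at hz
    have h' : hTY x.toKIdx c (shiftY x.toKIdx μ z) ≠ 0 := by intro h0; exact h (by rw [h0, hz])
    exact (mem_nearDomY_iff x c z).2 ⟨_, mem_cubeDomY_of_hTY_ne_zero x c h', (torusSupNorm_sub_shiftY_le_one x.toKIdx μ z).1⟩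

/-- a bond `⟨z − e_μ, z⟩` across which `h_□` varies has `z` one step from `□̃(c)`.
[cite: Balaban1985BackgroundPropagators, (3.88)–(3.89) p.409, p.410 L14–15; Balaban1984PropagatorsII, p.235] -/
theorem mem_nearDomY_of_bdiff (c : ↥(cubes x.toKIdx.D.toDomains)) (μ : Fin (d + 1)) {z : SiteY x.toKIdx}
    (h : hTY x.toKIdx c ((shiftY x.toKIdx μ).symm z) ≠ hTY x.toKIdx c z) : z ∈ nearDomY x c := by
  by_cases hz : hTY x.toKIdx c z ≠ 0
  · exact cubeDomY_subset_nearDomY x c (mem_cubeDomY_of_hTY_ne_zero x c hz)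
  · push Not at hz
    have h' : hTY x.toKIdx c ((shiftY x.toKIdx μ).symm z) ≠ 0 := by intro h0; exact h (by rw [h0, hz])
    exact (mem_nearDomY_iff x c z).2 ⟨_, mem_cubeDomY_of_hTY_ne_zero x c h', (torusSupNorm_sub_shiftY_le_one x.toKIdx μ z).2⟩

/-- an averaging pair `(z, w)` across which `h_□` varies lies in `□̃(c)` (block-mates: `□̃(c)` is a union of blocks).
[cite: Balaban1985BackgroundPropagators, (3.88) p.409 (second line), p.408 («□̃»); Balaban1984PropagatorsII, (2.14) p.225] -/
theorem mem_cubeDomY_of_avg (c : ↥(cubes x.toKIdx.D.toDomains)) {z w : SiteY x.toKIdx} (hw : avgCoeffY x.toKIdx z w ≠ 0)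
    (h : hTY x.toKIdx c z ≠ hTY x.toKIdx c w) : z ∈ cubeDomY x c := by
  by_cases hz : hTY x.toKIdx c z ≠ 0
  · exact mem_cubeDomY_of_hTY_ne_zero x c hz
  · push Not at hz
    have h' : hTY x.toKIdx c w ≠ 0 := by intro h0; exact h (by rw [h0, hz])
    have hw' := mem_cubeDomY_of_hTY_ne_zero x c h'
    unfold cubeDomY at hw' ⊢
    rw [Finset.mem_filter] at hw' ⊢
    exact ⟨Finset.mem_univ _, blkOf_eq_of_avgCoeffY_ne_zero x hw ▸ hw'.2⟩

end Near

/-! ## §3 The letters `G′_□(U)`, `K(h_□)(U)G′_□(U)M_{h_□}` under `agreeWalkY` -/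

section Letters

variable {d ℓ : ℕ} {hd : 1 ≤ d + 1} {hL : Odd (ℓ + 1) ∧ 1 < ℓ + 1} {b₀ b₁ : ℝ} {Mstar : ℕ}
variable {𝔸 : Type} [NormedRing 𝔸] [NormedAlgebra ℂ 𝔸] [CompleteSpace 𝔸] [FiniteDimensional ℝ 𝔸] {κ : Type} [Fintype κ] [DecidableEq κ]
variable (x : MemberY d ℓ hd hL b₀ b₁ Mstar) (b : Module.Basis κ ℝ 𝔸) (B : B9.Backgrounds) (cfg : B.Cfg → CfgY 𝔸 x.toKIdx) (parS : SiteParY 𝔸 x.toKIdx)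
variable (bI : FBondY x.toKIdx → IBondY x.toKIdx)

omit [FiniteDimensional ℝ 𝔸] in
/-- ★ **`G′_□(U) = G′_□(U′)` UNDER `agreeWalkY`** (def-Y's `GsqY_congr_of_agree` on `□̃(c) ⊂ nearDomY(c)`).
[cite: Balaban1985BackgroundPropagators, p.410 L14–15 («G′_□ depends on U restricted to Ω₀(□) ⊂ □̃⁵»), pp.408–409 (G′_□)] -/
theorem GsqY_congr_of_agreeWalkY (c : ↥(cubes x.toKIdx.D.toDomains)) {U U' : B.Cfg} (hA : agreeWalkY x B cfg parS c U U') :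
    GsqY x.toKIdx parS (cubeDomY x c) (cfg U) = GsqY x.toKIdx parS (cubeDomY x c) (cfg U') :=
  GsqY_congr_of_agree x.toKIdx parS (cubeDomY x c) (fun z hz μ => hA.1 z (cubeDomY_subset_nearDomY x c hz) μ) (fun z hz w hw => hA.2 z hz w hw)

omit [DecidableEq κ] in
/-- ★ **the record's `Gsq U □ = Gsq U′ □` under `agreeWalkY`** (`LocalityDir.gsq`, operator form). [cite: Balaban1985BackgroundPropagators, p.410 L14–15, (3.87) p.409] -/
theorem gsqcoS_congr_of_agreeWalkY (c : ↥(cubes x.toKIdx.D.toDomains)) {U U' : B.Cfg} (hA : agreeWalkY x B cfg parS c U U') :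
    gsqcoS x b B cfg parS c U = gsqcoS x b B cfg parS c U' := by
  show GcoS x.toKIdx b B cfg (GsqY x.toKIdx parS (cubeDomY x c)) U = GcoS x.toKIdx b B cfg (GsqY x.toKIdx parS (cubeDomY x c)) U'
  unfold GcoS
  rw [GsqY_congr_of_agreeWalkY x B cfg parS c hA]

omit [FiniteDimensional ℝ 𝔸] in
/-- ★★ **THE 𝔸-LEVEL `kgh`: `K(h_□)(U)G′_□(U)M_{h_□} = K(h_□)(U′)G′_□(U′)M_{h_□}` AS OPERATORS** under `agreeWalkY`: `G′_□` is local (above), and `K(h_□)(U)` reads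
`U` only across bonds ∕ averaging pairs where `h_□` varies (§1) — base points one step from `□̃(c)` (§2), where the configurations agree.
[cite: Balaban1985BackgroundPropagators, p.410 L14–15 («… and the operator K(h) is semi-local»), (3.88) p.409, (3.24) p.394] -/
theorem KhY_GsqY_cutMulY_congr_of_agreeWalkY (c : ↥(cubes x.toKIdx.D.toDomains)) {U U' : B.Cfg} (hA : agreeWalkY x B cfg parS c U U') :
    KhY x.toKIdx parS (hTY x.toKIdx c) (cfg U) * GsqY x.toKIdx parS (cubeDomY x c) (cfg U) * cutMulY (hTY x.toKIdx c)
      = KhY x.toKIdx parS (hTY x.toKIdx c) (cfg U') * GsqY x.toKIdx parS (cubeDomY x c) (cfg U') * cutMulY (hTY x.toKIdx c) := by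
  rw [GsqY_congr_of_agreeWalkY x B cfg parS c hA]
  refine LinearMap.ext fun Λ => funext fun z => ?_
  simp only [Module.End.mul_apply]
  exact KhY_apply_congr_of_reads x.toKIdx parS (hTY x.toKIdx c) _ z
    (fun μ hμ => (hA.1 z (mem_nearDomY_of_fdiff x c μ hμ) μ).1)
    (fun μ hμ => (hA.1 z (mem_nearDomY_of_bdiff x c μ hμ) μ).2)
    (fun w hw hzw => hA.2 z (mem_cubeDomY_of_avg x c hw hzw) w hw)

omit [DecidableEq κ] in
/-- ★ **THE RECORD'S `K`-LETTER IS THE COORDINATE MODEL OF PRINT'S `K(h_□)(U)`**: `KopDir (opsWalkY …) (dirOpsWalkY …) (dirLettersWalkY …) U □ = (η²c_R)⁻¹ • φ(K(h_□)(U))`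
(def-Y's split `K(h) = Σ_μ P_μ∇_{U,μ} + C`, `KhY_eq_grad_right`, through the algebra morphism `φ = coordAlgHom` of part 1).
[cite: Balaban1985BackgroundPropagators, (3.88) p.409; Balaban1984PropagatorsII, (2.39) p.229] -/
theorem kopDir_opsWalkY_eq (U : B.Cfg) (c : ↥(cubes x.toKIdx.D.toDomains)) :
    KopDir (opsWalkY x b B cfg parS bI) (dirOpsWalkY x b B cfg parS bI) (dirLettersWalkY x b B cfg parS bI) U c
      = (etaS x.toKIdx ^ 2 * cR39 b)⁻¹ • coordAlgHom x.toKIdx b (KhY x.toKIdx parS (hTY x.toKIdx c) (cfg U)) := by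
  show (∑ μ, pcoS x.toKIdx b B cfg U (hTY x.toKIdx c) μ * dirDcoS x.toKIdx b B cfg U μ) + ccoS x.toKIdx b B cfg parS U (hTY x.toKIdx c) = _
  have eP : ∀ μ, pcoS x.toKIdx b B cfg U (hTY x.toKIdx c) μ * dirDcoS x.toKIdx b B cfg U μ
      = (etaS x.toKIdx ^ 2 * cR39 b)⁻¹ • coordAlgHom x.toKIdx b (pKY x.toKIdx (cfg U) (hTY x.toKIdx c) μ * cdSL x.toKIdx (cfg U) μ) := by
    intro μ
    have e1 : pcoS x.toKIdx b B cfg U (hTY x.toKIdx c) μ = (etaS x.toKIdx * cR39 b)⁻¹ • coordAlgHom x.toKIdx b (pKY x.toKIdx (cfg U) (hTY x.toKIdx c) μ) := rfl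
    have e2 : dirDcoS x.toKIdx b B cfg U μ = (etaS x.toKIdx)⁻¹ • coordAlgHom x.toKIdx b (cdSL x.toKIdx (cfg U) μ) := rfl
    rw [e1, e2, smul_mul_smul_comm, ← map_mul]
    congr 1
    ring
  have eC : ccoS x.toKIdx b B cfg parS U (hTY x.toKIdx c) = (etaS x.toKIdx ^ 2 * cR39 b)⁻¹ • coordAlgHom x.toKIdx b (cKY x.toKIdx parS (hTY x.toKIdx c) (cfg U)) := rfl
  simp only [eP, eC, ← Finset.smul_sum, ← smul_add, ← map_sum, ← map_add, ← KhY_eq_grad_right]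

end Letters

/-! ## §4 `LocalityDir` at the record -/

section Record

variable {d ℓ : ℕ} {hd : 1 ≤ d + 1} {hL : Odd (ℓ + 1) ∧ 1 < ℓ + 1} {b₀ b₁ : ℝ} {Mstar : ℕ}
variable {𝔸 : Type} [NormedRing 𝔸] [NormedAlgebra ℂ 𝔸] [CompleteSpace 𝔸] [FiniteDimensional ℝ 𝔸] {κ : Type} [Fintype κ] [DecidableEq κ]
variable (x : MemberY d ℓ hd hL b₀ b₁ Mstar) (b : Module.Basis κ ℝ 𝔸) (B : B9.Backgrounds) (cfg : B.Cfg → CfgY 𝔸 x.toKIdx) (parS : SiteParY 𝔸 x.toKIdx)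
variable (bI : FBondY x.toKIdx → IBondY x.toKIdx)

/-- ★★★ **`hloc` AT THE RECORD**: `LocalityDir (opsWalkY …) (dirOpsWalkY …) (dirLettersWalkY …) (rdWalkY …)` — both printed locality inputs of Corollary 3.8 («G′_□ depends on
U restricted to Ω₀(□) ⊂ □̃⁵, and the operator K(h) is semi-local») HOLD for def-Y's genuine letters read through the coordinate model, with the walk reading's
agreement predicate `agreeWalkY` (bond variables one step around `□̃(c)`, averaging transporters issuing from `□̃(c)`).  Hypothesis-free (any transporter letter
`parS`, any basis `b`, any pin `bI`). [cite: Balaban1985BackgroundPropagators, Cor. 3.8 p.410 L14–15, (3.87)–(3.88) p.409, (3.24) p.394; Balaban1984PropagatorsII, (2.37)–(2.39) p.229] -/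
theorem localityDir_opsWalkY :
    LocalityDir (opsWalkY x b B cfg parS bI) (dirOpsWalkY x b B cfg parS bI) (dirLettersWalkY x b B cfg parS bI) (rdWalkY x B cfg parS) := by
  refine ⟨fun c U U' hA => ?_, fun c U U' hA => ?_⟩
  · have hA' : agreeWalkY x B cfg parS c U U' := hA
    show mulOp (hWalkY x c) * gsqcoS x b B cfg parS c U * mulOp (hWalkY x c) = mulOp (hWalkY x c) * gsqcoS x b B cfg parS c U' * mulOp (hWalkY x c)
    rw [gsqcoS_congr_of_agreeWalkY x b B cfg parS c hA']
  · have hA' : agreeWalkY x B cfg parS c U U' := hA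
    show KopDir (opsWalkY x b B cfg parS bI) (dirOpsWalkY x b B cfg parS bI) (dirLettersWalkY x b B cfg parS bI) U c * gsqcoS x b B cfg parS c U *
        mulOp (hWalkY x c)
      = KopDir (opsWalkY x b B cfg parS bI) (dirOpsWalkY x b B cfg parS bI) (dirLettersWalkY x b B cfg parS bI) U' c * gsqcoS x b B cfg parS c U' *
        mulOp (hWalkY x c)
    have eG : ∀ V : B.Cfg, gsqcoS x b B cfg parS c V = (etaS x.toKIdx ^ 2 * cR39 b) • coordAlgHom x.toKIdx b (GsqY x.toKIdx parS (cubeDomY x c) (cfg V)) :=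
      fun V => rfl
    have eM : mulOp (hWalkY (κ := κ) x c) = coordAlgHom x.toKIdx b (cutMulY (hTY x.toKIdx c)) := mulOp_hWalkY_eq_mulcoS x b c
    rw [kopDir_opsWalkY_eq, kopDir_opsWalkY_eq, eG, eG, eM]
    simp only [mul_smul_comm, smul_mul_assoc, ← map_mul, KhY_GsqY_cutMulY_congr_of_agreeWalkY x B cfg parS c hA']

end Record

end Literature.MathematicalPhysics.QuantumFieldTheory.Balaban1983to89.B9WalkLettersOpsLocality

end
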